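import Summits.RiemannHypothesis.RiemannHypothesis.Theorems.SemilocalNegCertUptoHundredThirtyOneKinkedPieces1
import Summits.RiemannHypothesis.RiemannHypothesis.Theorems.SemilocalNegCertUptoHundredThirtyOneKinkedPieces2
import Summits.RiemannHypothesis.RiemannHypothesis.Theorems.SemilocalNegCertUptoHundredThirtyOneKinkedPieces3
import HarnessLib

/-!
# Semi-local threshold of the `{∞} ∪ {p < 137}` form, negative side: `a*({2,…,131}) ≤ 1263/512` — the wall `q = 137` from a KINKED (piecewise-cubic) witness (part 13/14: the composition of the 437 piece facts)

Cell `rh-explicit` (HOME `run/shared/lean/pub/rh-explicit/`), seat cc-s2-4 (A4 SEMILOCAL-TABLE, kernel column; pipeline gen11 `mkkinked.py`).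
Honest framing: theorems about the tree's `weilSemilocalThreshold S`; nothing here bears on RH.  No data is trusted: every bound is a
`decide +kernel` fact of the piecewise certificate `SemilocalPiecewiseCert.lean` (cc-s2-4 gen8).

Instance: `S = {p < 137}`, window `b = 1263/512` (last /1024 value below `(log 139)/2`), `N = 138`, 45 atoms; odd piecewise-cubic
witness with 20 slope breaks at the atom images `|b − log n|` nearest `0` (atoms `n = 11, 13, 9, 16, 17, 8, 19, 7, 23, 25, 27, 5, 29, 31, 32, 4, 37, 41, 43, 3`,
rounded to `/1024`); float finder `Re Q/‖G‖² = -2.626e-04` (no polar credit); orders `(10, 4, 8, 4, 10, 40)`, 437 `t`-pieces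
(far widths ≤ 1/4); exact kernel margin `(rhs − lhs)/‖G‖² = 2.6311e-04`.  ⇒ **`a*({p < 137}) ≤ 1263/512 < (log 139)/2`**.
The instance is split for the gate into part 1
(table, certificate, `checkMainPW`, the atom side in kernel chunks of ≤ 4 atoms via `SemilocalPiecewiseCertSplit.lean`), parts 2–8
(68 piece facts each in the FLEX layout of `SemilocalPiecewiseCertFlex.lean` (cc-s2-4 gen12, CC4-LEAN §17.2): piece `0` by `checkPiecePW`,
every far piece by `checkPieceFlex i ⟨n, m, K, m', u₀⟩` with the orders that piece needs (mean majorant degree ≈ 62 instead of 176) and a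
short dyadic centre `u₀ ≤ u_K(T₀)` — same witness, same cuts, claims recomputed (`⌈exact⌉ + 1`), kernel margin `2.6309e-04`·‖G‖²; each
fact file imports part 1 only), the Pieces part (composition) and the Final part (theorems).  Folklore throughout.
-/

set_option autoImplicit false
set_option linter.dupNamespace false  -- the mandated namespace repeats `RiemannHypothesis`
set_option Elab.async false  -- serialise the kernel facts: in parallel they exhaust the node's per-process heap (cc-s2-4 gen11, CC4-LEAN §16.10)

noncomputable section

open Complex Filter Set MeasureTheory Topology
open scoped Real

namespace Summit.RiemannHypothesis.RiemannHypothesis.Theorems.SemilocalPolyWitness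

open MeasureTheory Set Finset Real
open Literature.NumberTheory.LFunctions
open Summit.RiemannHypothesis.RiemannHypothesis.Theorems.MotivicDoor
open Summit.RiemannHypothesis.RiemannHypothesis.Theorems.MotivicDoor.SemilocalThreshold
open Summit.RiemannHypothesis.RiemannHypothesis.Theorems.MotivicDoor.SemilocalMarkov
open LQ

set_option maxRecDepth 8000 in  -- `i < cuts.length` unfolds a 437-element list
/-- all pieces of `certUptoHundredThirtyOneKinked` check (piece `0` with the global orders, the others in the FLEX form). -/
theorem check_UptoHundredThirtyOneKinked_pieces : ∀ i, i < certUptoHundredThirtyOneKinked.cuts.length →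
    certUptoHundredThirtyOneKinked.checkPiecePW i = true ∨ ∃ o, certUptoHundredThirtyOneKinked.checkPieceFlex i o = true := by
  intro i hi
  have hi' : i < 437 := hi
  by_cases h1 : i < 150
  · exact check_UptoHundredThirtyOneKinked_pieces_1 i (by omega) h1
  by_cases h2 : i < 300
  · exact check_UptoHundredThirtyOneKinked_pieces_2 i (by omega) h2
  exact check_UptoHundredThirtyOneKinked_pieces_3 i (by omega) hi'

end Summit.RiemannHypothesis.RiemannHypothesis.Theorems.SemilocalPolyWitness

end
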